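import Mathlib
import Literature.AlgebraicGeometry.Resolution.CobordantGame
import Summits.ResolutionOfSingularities.ResolutionOfSingularities.Theorems.WeightedInvariantLocalWeightedDropGradedSliceWildWitness
import Summits.ResolutionOfSingularities.ResolutionOfSingularities.Theorems.WeightedInvariantLocalWeightedDropGradedSliceTameTools

/-!
# `WeightedInvariant.LocalWeightedDrop`: the WILD-SLICE SPECIMEN — at a wild, NON-TRANSVERSAL frozen coordinate the slice can be
# strictly EASIER than the successor: ranks (slice, successor) = (0, 1); the naive wild half of T3″ is refutable

Route `ResolutionOfSingularities/WeightedInvariant`, crux `LocalWeightedDrop` (stmt-ResolutionOfSingularities-8899).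
[OURS · L1 W4.3] — res-type-099 (gen 13) as res-type-060's kernel co-hand on the WILD SLICE CLAUSE (res-L1-w43-plan-1 DEALS
gen 9 #23).  Object probed: the one-sided slice statement T3″ of the graded-game line (ideator res-L1-w43-idea-1, Sketch v4 §5)
«`GradedWonBy α (n+1) (sliceLattice (succLattice L w c) v) (sliceGerm v g) → GradedWonBy α (n+2) (succLattice L w c) g`»,
PROVED by res-type-060 at TAME frozen coordinates (`gradedWonBy_of_slice_tame`, p515424: `c_v ≠ 0 < w_v`, `(w_v : k) ≠ 0`) and
left open at WILD ones (`p ∣ w_v`); its «same rank iff» ancestor R3-T3 was refuted at a wild point in the OTHER direction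
(`not_gradedWonBy_slice_iff_asTyped`, p508918: successor rank `0`, slice rank `1`).  Nothing here is a statement of the
manuscript under review on ladder RESOLUTION; T3″ is OURS; this is not a verdict on card A.  AI proof, weaker than expert review.

**The specimen** (characteristic `2`, every field `k ⊇ 𝔽₂`).  `F = x_u^10 + (x_v + x_u²)³·x_z² ∈ k[[x_z, x_u, x_v]]` (indices
`0, 1, 2`), `L = ⊤`, identity coordinate change, weights `w = (1, 1, 2)`, exceptional point `c = (0, 1, 1)`: BOTH `u` and `v` are
translated, the stabiliser is trivial (`gcd(1, 2) = 1`, so every lattice in sight is `⊤`), and the frozen coordinate `v` = last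
is WILD (`w_v = 2 = 0` in `k`).  Exponent `a = 8`, successor
`g = s²(1+y_u)^10 + (y_v + y_u²)³·y_z² ∈ k[[s, y_z, y_u, y_v]]` — in the coordinates `(s(1+y_u)^5, y_z, y_u, y_v + y_u²)` this
is `W₄ = x₀² + x₃³x₁²`, the cylinder over the arc-lemma witness `x² + y³z²` (`…GradedSliceWildWitness`).
* `subst_cruxChart_wildSpecimen`, `isSuccessorAt_wildSpecimen` — `F(chart_c) = s⁸·g`, a genuine position of the graded game;
  `succLattice_wildSpecimen_eq_top`, `sliceLattice_top` — the propagated and slice lattices are `⊤`;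
* `subst_sliceGerm_last` (tool) and `gradedWonBy_zero_slice_wildSpecimen` — **the SLICE
  `g|_{y_v=0} = s²(1+y_u)^10 + y_u^6·y_z² = (s(1+y_u)^5 + y_u³y_z)²` is the square of a smooth germ: graded rank `0`**;
* `not_gradedWonBy_zero_wildSpecimen` — **the SUCCESSOR has NO graded one-move win** (any lattice; via `W₄`); its rank is
  exactly `1` (companion `…GradedSliceWildProbesRankOne`): ranks (slice, successor) = (0, 1), the mirror image of p508918;
* `not_gradedWonBy_of_slice_wild_naive` — **T3″ with `(w_v : k) = 0` in place of `(w_v : k) ≠ 0` is REFUTABLE** (`k = 𝔽₂`,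
  `α = 0`); `not_gradedWonBy_of_slice_asTyped_oneSided` — the same with idea-1's full R3-T3 binder list, one-sided.

**Reading (input for res-type-060's WILD-SLICE-CLAUSE memo / idea-1 / lead-1; words theirs).**  The orbit through `c` is
`y_v = y_u²`: TANGENT to the slice `{y_v = 0}` since `w_v = 2 = 0` in `k`; a non-transversal slice is a Frobenius pull-back of
the transversal one (`h = H((1+y_u)s, y_z/(1+y_u), (y_u/(1+y_u))²)`, `H = g|_{y_u=0} = s² + y_v³y_z²`) and can be strictly
easier.  Suggested hypothesis for the wild stub: the frozen coordinate has MINIMAL `p`-adic weight valuation among the translated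
ones (`p ∤ w_v / gcd{w_j : c_j ≠ 0 < w_j}`); the open wild clause is then `p ∣ gcd`.  W-a (rank shift `+1`) is consistent here.
-/

set_option linter.dupNamespace false -- mandated namespace of this single-conjunct summit
set_option autoImplicit false

namespace Summit.ResolutionOfSingularities.ResolutionOfSingularities.Theorems

namespace GradedGame

open MvPowerSeries
open Literature.AlgebraicGeometry.Resolution
open Literature.AlgebraicGeometry.Resolution.FormalCoordChange (linMat two_le_order_iff two_le_order_subst)

variable {k : Type} [Field k]

/-! ## §1 Tools -/

/-- Leibniz at degree one: `[y_z](φ·ψ) = φ(0)·[y_z]ψ + [y_z]φ·ψ(0)`. [OURS · L1 W4.3] -/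
theorem coeff_single_one_mul_leibniz {m : ℕ} (z : Fin m) (φ ψ : MvPowerSeries (Fin m) k) :
    coeff (Finsupp.single z 1) (φ * ψ) =
      constantCoeff φ * coeff (Finsupp.single z 1) ψ + coeff (Finsupp.single z 1) φ * constantCoeff ψ := by
  classical
  rw [coeff_mul, Finsupp.antidiagonal_single, Finset.sum_map, Finset.Nat.antidiagonal_succ, Finset.sum_cons,
    Finset.Nat.antidiagonal_zero, Finset.map_singleton, Finset.sum_singleton]
  simp only [Function.Embedding.coe_prodMap, Function.Embedding.coeFn_mk, Prod.map_apply, Function.Embedding.refl_apply,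
    Finsupp.single_zero, coeff_zero_eq_constantCoeff_apply]

/-- Linear coefficient of a power: `[y_z](φ^e) = e·φ(0)^{e-1}·[y_z]φ`. [OURS · L1 W4.3] -/
theorem coeff_single_one_pow_leibniz {m : ℕ} (z : Fin m) (φ : MvPowerSeries (Fin m) k) (e : ℕ) :
    coeff (Finsupp.single z 1) (φ ^ e) = (e : k) * constantCoeff φ ^ (e - 1) * coeff (Finsupp.single z 1) φ := by
  induction e with
  | zero => rw [pow_zero, coeff_one, if_neg (Finsupp.single_ne_zero.mpr one_ne_zero), Nat.cast_zero, zero_mul, zero_mul]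
  | succ e ih =>
    rw [pow_succ, coeff_single_one_mul_leibniz, ih, map_pow, Nat.cast_succ, Nat.add_sub_cancel]
    cases e with
    | zero => simp
    | succ e => rw [Nat.add_sub_cancel, pow_succ]; ring

/-- **SUBSTITUTING INTO THE SLICE = SUBSTITUTING INTO `g` WITH THE FROZEN COORDINATE KILLED**: for a substitution family `T`
with zero constant terms and `T_v = 0` (`v` = last), `(g|_{v=0})(T ∘ castSucc) = g(T)`.  From `g ≡ (g|_{v=0}) ⊗ 1 mod y_v`
(`subst_eq_subst_cylinder_sliceGerm`) and `subst_cylinder`. [OURS · L1 W4.3] -/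
theorem subst_sliceGerm_last {n m : ℕ} (T : Fin (n + 1 + 1) → MvPowerSeries (Fin m) k) (hT : ∀ i, constantCoeff (T i) = 0)
    (hlast : T (Fin.last (n + 1)) = 0) (g : MvPowerSeries (Fin (n + 1 + 1)) k) :
    subst (fun j => T (Fin.castSucc j)) (sliceGerm (Fin.last n) g) = subst T g := by
  have hTs := hasSubst_of_constantCoeff_zero hT
  rw [subst_eq_subst_cylinder_sliceGerm T hTs hlast g, subst_cylinder hTs]

/-- The slice lattice of `⊤` is `⊤`. [OURS · L1 W4.3] -/
theorem sliceLattice_top {n : ℕ} (i₀ : Fin n) : sliceLattice (⊤ : AddSubgroup (Fin (n + 1) → ℤ)) i₀ = ⊤ := by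
  rw [eq_top_iff]
  intro u _
  rw [mem_sliceLattice_iff]
  refine ⟨Fin.insertNth (α := fun _ => ℤ) i₀.succ 0 u, AddSubgroup.mem_top _, ?_⟩
  funext j
  exact Fin.insertNth_apply_succAbove (α := fun _ => ℤ) i₀.succ 0 u j

/-! ## §2 The specimen -/

section Specimen

/-- **THE CHART COMPUTATION**: `F(chart_c) = s⁸·g` for `F = x_u^10 + (x_v + x_u²)³x_z²`, `w = (1,1,2)`, `c = (0,1,1)`
(characteristic `2`: the cross term `2y_u` of `(1 + y_u)²` dies). [OURS · L1 W4.3] -/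
theorem subst_cruxChart_wildSpecimen [CharP k 2] :
    subst (CobordantGame.cruxChart k ![1, 1, 2] ![(0 : k), 1, 1])
        (X 1 ^ 10 + (X 2 + X 1 ^ 2) ^ 3 * X 0 ^ 2 : MvPowerSeries (Fin 3) k) =
      X 0 ^ 8 * (X 0 ^ 2 * (1 + X 2) ^ 10 + (X 3 + X 2 ^ 2) ^ 3 * X 1 ^ 2 : MvPowerSeries (Fin 4) k) := by
  haveI : CharP (MvPowerSeries (Fin 4) k) 2 := charP_of_injective_ringHom MvPowerSeries.C_injective 2
  have h2 : (2 : MvPowerSeries (Fin 4) k) = 0 := CharP.cast_eq_zero _ 2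
  have hC := hasSubst_cruxChart (k := k) ![1, 1, 2] ![(0 : k), 1, 1]
  rw [subst_add hC, subst_mul hC, subst_pow hC, subst_pow hC, subst_pow hC, subst_add hC, subst_pow hC, subst_X hC, subst_X hC,
    subst_X hC, cruxChart_of_pos _ _ 0 (by simp), cruxChart_of_pos _ _ 1 (by simp), cruxChart_of_pos _ _ 2 (by simp)]
  simp only [Matrix.cons_val_zero, Matrix.cons_val_one, Matrix.head_cons, Matrix.cons_val_two, Matrix.tail_cons, map_zero,
    map_one, zero_add, Fin.succ_zero_eq_one, pow_one]
  have h1 : (1 : Fin 3).succ = (2 : Fin 4) := rfl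
  have h3 : (2 : Fin 3).succ = (3 : Fin 4) := rfl
  rw [h1, h3]
  linear_combination (X 0 ^ 8 * X 1 ^ 2 * (1 + X 2) *
    (3 * (X 3 + X 2 ^ 2) ^ 2 + 6 * (X 3 + X 2 ^ 2) * (1 + X 2) + 4 * (1 + X 2) ^ 2)) * h2

/-- **`g = W₄` IN TWISTED COORDINATES**: `g = W₄(x₃ ↦ x₃ + x₂²)(x₀ ↦ x₀(1+x₂)^5)` with `W₄ = x₀² + x₃³x₁²` (all characteristics).
[OURS · L1 W4.3] -/
theorem wildSpecimen_eq_subst :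
    (X 0 ^ 2 * (1 + X 2) ^ 10 + (X 3 + X 2 ^ 2) ^ 3 * X 1 ^ 2 : MvPowerSeries (Fin 4) k) =
      subst (Function.update (fun i => (X i : MvPowerSeries (Fin 4) k)) 0 (X 0 * (1 + X 2) ^ 5))
        (subst (Function.update (fun i => (X i : MvPowerSeries (Fin 4) k)) 3 (X 3 + X 2 ^ 2))
          (X 0 ^ 2 + X 3 ^ 3 * X 1 ^ 2 : MvPowerSeries (Fin 4) k)) := by
  have hA0 : ∀ i, constantCoeff (Function.update (fun i => (X i : MvPowerSeries (Fin 4) k)) 3 (X 3 + X 2 ^ 2) i) = 0 := by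
    intro i
    by_cases hi : i = 3
    · subst hi; simp [constantCoeff_X]
    · rw [Function.update_of_ne hi]; exact constantCoeff_X i
  have hB0 : ∀ i, constantCoeff (Function.update (fun i => (X i : MvPowerSeries (Fin 4) k)) 0 (X 0 * (1 + X 2) ^ 5) i) = 0 := by
    intro i
    by_cases hi : i = 0
    · subst hi; simp [constantCoeff_X]
    · rw [Function.update_of_ne hi]; exact constantCoeff_X i
  have hA := hasSubst_of_constantCoeff_zero hA0
  have hB := hasSubst_of_constantCoeff_zero hB0
  simp only [subst_add hA, subst_mul hA, subst_pow hA, subst_X hA, subst_add hB, subst_mul hB, subst_pow hB, subst_X hB,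
    Function.update_self, ne_eq, Fin.reduceEq, not_false_eq_true, Function.update_of_ne]; ring

/-- `g ∈ 𝔪²`. [OURS · L1 W4.3] -/
theorem two_le_order_wildSpecimen :
    2 ≤ (X 0 ^ 2 * (1 + X 2) ^ 10 + (X 3 + X 2 ^ 2) ^ 3 * X 1 ^ 2 : MvPowerSeries (Fin 4) k).order := by
  rw [wildSpecimen_eq_subst]
  refine two_le_order_subst _ (fun i => ?_) _ (two_le_order_subst _ (fun i => ?_) _ two_le_order_witness4)
  · by_cases hi : i = 0
    · subst hi; simp [constantCoeff_X]
    · rw [Function.update_of_ne hi]; exact constantCoeff_X i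
  · by_cases hi : i = 3
    · subst hi; simp [constantCoeff_X]
    · rw [Function.update_of_ne hi]; exact constantCoeff_X i

/-- `s ∤ g` (killing `s` leaves `(y_v + y_u²)³·y_z² ≠ 0`). [OURS · L1 W4.3] -/
theorem not_X_dvd_wildSpecimen :
    ¬ X 0 ∣ (X 0 ^ 2 * (1 + X 2) ^ 10 + (X 3 + X 2 ^ 2) ^ 3 * X 1 ^ 2 : MvPowerSeries (Fin 4) k) := by
  rintro ⟨q, hq⟩
  set κ := Function.update (fun i => (X i : MvPowerSeries (Fin 4) k)) 0 0 with hκ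
  have hκ0 : ∀ i, constantCoeff (κ i) = 0 := by
    intro i
    by_cases hi : i = 0
    · subst hi; simp [hκ]
    · rw [hκ, Function.update_of_ne hi]; exact constantCoeff_X i
  have hκs := hasSubst_of_constantCoeff_zero hκ0
  have hs1 : subst κ (1 : MvPowerSeries (Fin 4) k) = 1 := by rw [← coe_substAlgHom hκs, map_one]
  have h := congrArg (subst κ) hq
  simp only [subst_add hκs, subst_mul hκs, subst_pow hκs, subst_X hκs, hs1] at h
  simp only [hκ, Function.update_self, ne_eq, Fin.reduceEq, not_false_eq_true, Function.update_of_ne] at h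
  -- `h : 0² (1+y_u)^10 + (y_v + y_u²)³ y_z² = 0 · q(κ)`
  have hne : ((X 3 + X 2 ^ 2) ^ 3 * X 1 ^ 2 : MvPowerSeries (Fin 4) k) ≠ 0 := by
    refine mul_ne_zero (pow_ne_zero _ fun h0 => ?_) (pow_ne_zero _ (FormalCoordChange.X_ne_zero' 1))
    have := congrArg (coeff (Finsupp.single 3 1)) h0
    simp [coeff_X, coeff_X_pow, Finsupp.single_eq_single_iff] at this
  apply hne
  simpa using h

/-- **THE SPECIMEN IS A GENUINE POSITION OF THE GRADED GAME**: `IsSuccessorAt F X (1,1,2) (0,1,1) 8 g`. [OURS · L1 W4.3] -/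
theorem isSuccessorAt_wildSpecimen [CharP k 2] :
    IsSuccessorAt (X 1 ^ 10 + (X 2 + X 1 ^ 2) ^ 3 * X 0 ^ 2 : MvPowerSeries (Fin 3) k) (fun i => X i) ![1, 1, 2]
      ![(0 : k), 1, 1] 8 (X 0 ^ 2 * (1 + X 2) ^ 10 + (X 3 + X 2 ^ 2) ^ 3 * X 1 ^ 2 : MvPowerSeries (Fin 4) k) := by
  refine ⟨⟨1, by simp, by simp⟩, ?_, not_X_dvd_wildSpecimen, (two_le_order_iff _).mp two_le_order_wildSpecimen⟩
  have hself : subst (fun i : Fin 3 => (X i : MvPowerSeries (Fin 3) k)) (X 1 ^ 10 + (X 2 + X 1 ^ 2) ^ 3 * X 0 ^ 2 :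
      MvPowerSeries (Fin 3) k) = (X 1 ^ 10 + (X 2 + X 1 ^ 2) ^ 3 * X 0 ^ 2 : MvPowerSeries (Fin 3) k) := by
    rw [show (fun i : Fin 3 => (X i : MvPowerSeries (Fin 3) k)) = X from rfl, subst_self]; rfl
  rw [hself]
  exact subst_cruxChart_wildSpecimen

end Specimen

/-! ## §3 The propagated lattice is `⊤` -/

/-- At `c = (0,1,1)` with weights `(1,1,2)` BOTH translated coordinates have trivial character and `gcd(1,2) = 1`: the propagated
lattice `succLattice ⊤ w c` is all of `ℤ⁴` (trivial stabiliser). [OURS · L1 W4.3] -/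
theorem succLattice_wildSpecimen_eq_top :
    succLattice (⊤ : AddSubgroup (Fin 3 → ℤ)) ![1, 1, 2] ![(0 : k), 1, 1] = ⊤ := by
  set L' := succLattice (⊤ : AddSubgroup (Fin 3 → ℤ)) ![1, 1, 2] ![(0 : k), 1, 1] with hL'
  have hgen : ∀ r : Fin 3 → ℤ, (Matrix.vecCons (∑ j, ((![1, 1, 2] : Fin 3 → ℕ) j : ℤ) * r j) r : Fin 4 → ℤ) ∈ L' :=
    fun r => AddSubgroup.subset_closure (Or.inl ⟨r, AddSubgroup.mem_top _, rfl⟩)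
  have h2 : (Pi.single 2 1 : Fin 4 → ℤ) ∈ L' :=
    AddSubgroup.subset_closure (Or.inr ⟨(1 : Fin 3), by simp, by simp, rfl⟩)
  have h3 : (Pi.single 3 1 : Fin 4 → ℤ) ∈ L' :=
    AddSubgroup.subset_closure (Or.inr ⟨(2 : Fin 3), by simp, by simp, rfl⟩)
  have h0 : (Pi.single 0 1 : Fin 4 → ℤ) ∈ L' := by
    have h := L'.sub_mem (hgen (Pi.single 1 1)) h2
    have he : (Matrix.vecCons (∑ j, ((![1, 1, 2] : Fin 3 → ℕ) j : ℤ) * (Pi.single 1 1 : Fin 3 → ℤ) j) (Pi.single 1 1) :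
        Fin 4 → ℤ) - Pi.single 2 1 = Pi.single 0 1 := by
      ext i; fin_cases i <;> simp [Fin.sum_univ_three]
    rwa [he] at h
  have h1 : (Pi.single 1 1 : Fin 4 → ℤ) ∈ L' := by
    have h := L'.sub_mem (hgen (Pi.single 0 1)) h0
    have he : (Matrix.vecCons (∑ j, ((![1, 1, 2] : Fin 3 → ℕ) j : ℤ) * (Pi.single 0 1 : Fin 3 → ℤ) j) (Pi.single 0 1) :
        Fin 4 → ℤ) - Pi.single 0 1 = Pi.single 1 1 := by
      ext i; fin_cases i <;> simp [Fin.sum_univ_three]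
    rwa [he] at h
  rw [eq_top_iff]
  intro v _
  have hv : v = ∑ i : Fin 4, v i • (Pi.single i 1 : Fin 4 → ℤ) := by
    ext j; simp [Finset.sum_apply, Pi.single_apply]
  rw [hv, Fin.sum_univ_four]
  exact L'.add_mem (L'.add_mem (L'.add_mem (L'.zsmul_mem h0 _) (L'.zsmul_mem h1 _)) (L'.zsmul_mem h2 _)) (L'.zsmul_mem h3 _)

/-! ## §4 The slice is graded-won with rank `0` -/

section Slice

/-- **THE SLICE OF THE SPECIMEN IS GRADED-WON WITH RANK `0`** (lattice `⊤` — the actual slice lattice, §3).  The slice is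
`h = g|_{y_v=0} = s²(1+y_u)^10 + y_u^6·y_z² = (s(1+y_u)^5 + y_u³·y_z)²`, the square of a SMOOTH germ (characteristic `2`!); the
coordinate change `s ↦ s − y_u³y_z·(1+y_u)^{-5}` straightens it to `s²(1+y_u)^10` (`subst_sliceGerm_last`, never computing `h` as
a series), and the divisorial move `w = (1,0,0)` has no singular successor (every `s`-saturation is `(c + s')²·unit`, constant
term `c² ≠ 0`). [OURS · L1 W4.3] -/
theorem gradedWonBy_zero_slice_wildSpecimen [CharP k 2] :
    GradedWonBy 0 3 ⊤ (sliceGerm (Fin.last 2)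
      (X 0 ^ 2 * (1 + X 2) ^ 10 + (X 3 + X 2 ^ 2) ^ 3 * X 1 ^ 2 : MvPowerSeries (Fin 4) k)) := by
  haveI : CharP (MvPowerSeries (Fin 3) k) 2 := charP_of_injective_ringHom MvPowerSeries.C_injective 2
  have h2 : (2 : MvPowerSeries (Fin 3) k) = 0 := CharP.cast_eq_zero _ 2
  obtain ⟨w', hw1, hw0, -⟩ := exists_inv_one_add_X (k := k) (2 : Fin 3)
  have hw5 : w' ^ 5 * (1 + X 2) ^ 5 = (1 : MvPowerSeries (Fin 3) k) := by rw [← mul_pow, hw1, one_pow]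
  set φ : MvPowerSeries (Fin 3) k := X 0 - X 2 ^ 3 * X 1 * w' ^ 5 with hφ
  set θ := Function.update (fun i => (X i : MvPowerSeries (Fin 3) k)) 0 φ with hθ
  have hφ0 : constantCoeff φ = 0 := by simp [hφ, constantCoeff_X]
  have hθ0 : ∀ i, constantCoeff (θ i) = 0 := by
    intro i
    by_cases hi : i = 0
    · subst hi; rw [hθ, Function.update_self]; exact hφ0
    · rw [hθ, Function.update_of_ne hi]; exact constantCoeff_X i
  have hθs := hasSubst_of_constantCoeff_zero hθ0
  -- the extension of `θ` by `y_v ↦ 0`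
  set T : Fin 4 → MvPowerSeries (Fin 3) k := ![φ, X 1, X 2, 0] with hT
  have hT0 : ∀ i, constantCoeff (T i) = 0 := by
    intro i; fin_cases i
    · exact hφ0
    · exact constantCoeff_X _
    · exact constantCoeff_X _
    · simp [hT]
  have hTs := hasSubst_of_constantCoeff_zero hT0
  have hTθ : (fun j : Fin 3 => T (Fin.castSucc j)) = θ := by
    funext j
    fin_cases j
    · simp [hT, hθ]
    · simp [hT, hθ]
    · simp [hT, hθ]
  have hs1 : subst T (1 : MvPowerSeries (Fin 4) k) = 1 := by rw [← coe_substAlgHom hTs, map_one]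
  -- the straightening `h(θ) = s²(1+y_u)^10`
  have hstr : subst θ (sliceGerm (Fin.last 2) (X 0 ^ 2 * (1 + X 2) ^ 10 + (X 3 + X 2 ^ 2) ^ 3 * X 1 ^ 2 :
      MvPowerSeries (Fin 4) k)) = X 0 ^ 2 * (1 + X 2) ^ 10 := by
    rw [← hTθ, subst_sliceGerm_last T hT0 (by simp [hT]) _]
    simp only [subst_add hTs, subst_mul hTs, subst_pow hTs, subst_X hTs, hs1]
    simp only [hT, Matrix.cons_val_zero, Matrix.cons_val_one, Matrix.head_cons, Matrix.cons_val_two, Matrix.cons_val_three,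
      Matrix.tail_cons, hφ]
    linear_combination (X 2 ^ 6 * X 1 ^ 2 - X 0 * X 2 ^ 3 * X 1 * w' ^ 5 * (1 + X 2) ^ 10) * h2 +
      (X 2 ^ 6 * X 1 ^ 2 * (w' ^ 5 * (1 + X 2) ^ 5 + 1)) * hw5
  rw [gradedWonBy_zero_iff]
  refine ⟨θ, ![1, 0, 0], ⟨⟨hθ0, ?_, ⟨0, by simp⟩⟩, fun _ _ _ => AddSubgroup.mem_top _⟩, ?_⟩
  · -- invertible linear part: `det = [s]φ = 1`
    rw [hθ, linPart_update_X, det_updateRow_one]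
    have hlin : coeff (Finsupp.single 0 1) φ = 1 := by
      rw [hφ, map_sub, coeff_X, if_pos rfl, coeff_single_one_mul_leibniz, coeff_single_one_mul_leibniz,
        coeff_single_one_pow_leibniz, coeff_single_one_pow_leibniz]
      simp [constantCoeff_X, coeff_X, Finsupp.single_eq_single_iff]
    rw [hlin]; exact isUnit_one
  · rintro c a g' ⟨⟨i, hwi, hci⟩, hfac, hndvd, hc0, -⟩
    have hi : i = 0 := by fin_cases i <;> simp_all
    subst hi
    have hC := hasSubst_cruxChart (k := k) ![1, 0, 0] c
    have hs1' : subst (CobordantGame.cruxChart k ![1, 0, 0] c) (1 : MvPowerSeries (Fin 3) k) = 1 := by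
      rw [← coe_substAlgHom hC, map_one]
    rw [hstr] at hfac
    simp only [subst_add hC, subst_mul hC, subst_pow hC, subst_X hC, hs1', cruxChart_of_pos ![1, 0, 0] c 0 (by simp),
      cruxChart_of_eq_zero ![1, 0, 0] c 2 (by simp)] at hfac
    simp only [Matrix.cons_val_zero, pow_one, Fin.succ_zero_eq_one] at hfac
    have h23 : (2 : Fin 3).succ = (3 : Fin 4) := rfl
    rw [h23] at hfac
    -- `hfac : (s (c₀ + s'))² (1 + y_u)^10 = s^a · g'`
    set G : MvPowerSeries (Fin 4) k := (C (c 0) + X 1) ^ 2 * (1 + X 3) ^ 10 with hG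
    have hfac' : X 0 ^ a * g' = X 0 ^ 2 * G := by rw [← hfac, hG]; ring
    have hG0 : constantCoeff G = c 0 ^ 2 := by simp [hG, constantCoeff_X]
    have hGnd : ¬ X 0 ∣ G := by
      rintro ⟨q, hq⟩
      have h := congrArg constantCoeff hq
      rw [hG0, map_mul, constantCoeff_X, zero_mul] at h
      exact pow_ne_zero 2 hci h
    obtain ⟨-, hgG⟩ := eq_of_X_pow_mul_eq hfac' hndvd hGnd
    rw [hgG, hG0] at hc0
    exact hci (pow_eq_zero_iff two_ne_zero |>.mp hc0)

end Slice

/-! ## §5 The successor has no graded one-move win -/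

/-- **THE SUCCESSOR OF THE SPECIMEN HAS NO GRADED ONE-MOVE WIN**, for ANY grading lattice and every field: `g = W₄(Φ)` for the
composite coordinate change `Φ` of `wildSpecimen_eq_subst` (zero constants, linear part of determinant `1`), and `W₄(Φ)` has none
(`not_gradedWonBy_zero_subst_witness4`). [OURS · L1 W4.3] -/
theorem not_gradedWonBy_zero_wildSpecimen (L : AddSubgroup (Fin 4 → ℤ)) :
    ¬ GradedWonBy 0 4 L (X 0 ^ 2 * (1 + X 2) ^ 10 + (X 3 + X 2 ^ 2) ^ 3 * X 1 ^ 2 : MvPowerSeries (Fin 4) k) := by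
  set ΦA := Function.update (fun i => (X i : MvPowerSeries (Fin 4) k)) 3 (X 3 + X 2 ^ 2) with hΦA
  set ΦB := Function.update (fun i => (X i : MvPowerSeries (Fin 4) k)) 0 (X 0 * (1 + X 2) ^ 5) with hΦB
  have hA0 : ∀ i, constantCoeff (ΦA i) = 0 := by
    intro i
    by_cases hi : i = 3
    · subst hi; simp [hΦA, constantCoeff_X]
    · rw [hΦA, Function.update_of_ne hi]; exact constantCoeff_X i
  have hB0 : ∀ i, constantCoeff (ΦB i) = 0 := by
    intro i
    by_cases hi : i = 0
    · subst hi; simp [hΦB, constantCoeff_X]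
    · rw [hΦB, Function.update_of_ne hi]; exact constantCoeff_X i
  have hAs := hasSubst_of_constantCoeff_zero hA0
  have hBs := hasSubst_of_constantCoeff_zero hB0
  have hAdet : IsUnit (linMat ΦA).det := by
    change IsUnit (Matrix.of fun i j => coeff (Finsupp.single j 1) (ΦA i)).det
    rw [hΦA, linPart_update_X, det_updateRow_one]
    simp [coeff_X, coeff_X_pow, Finsupp.single_eq_single_iff]
  have hBdet : IsUnit (linMat ΦB).det := by
    change IsUnit (Matrix.of fun i j => coeff (Finsupp.single j 1) (ΦB i)).det
    rw [hΦB, linPart_update_X, det_updateRow_one, coeff_single_X_mul, if_pos rfl, constantCoeff_one_add_X_pow]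
    exact isUnit_one
  -- the composite `Φ i = ΦA_i(ΦB)`
  set Φ : Fin 4 → MvPowerSeries (Fin 4) k := fun i => subst ΦB (ΦA i) with hΦ
  have hΦ0 : ∀ i, constantCoeff (Φ i) = 0 := fun i => constantCoeff_subst_eq_zero hBs hB0 (hA0 i)
  have hΦdet : IsUnit (linMat Φ).det := by
    rw [hΦ, linMat_comp ΦB ΦA hB0, Matrix.det_mul]
    exact hAdet.mul hBdet
  have hg : (X 0 ^ 2 * (1 + X 2) ^ 10 + (X 3 + X 2 ^ 2) ^ 3 * X 1 ^ 2 : MvPowerSeries (Fin 4) k) =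
      subst Φ (X 0 ^ 2 + X 3 ^ 3 * X 1 ^ 2 : MvPowerSeries (Fin 4) k) := by
    rw [wildSpecimen_eq_subst, subst_comp_subst_apply hAs hBs]
  rw [hg]
  exact not_gradedWonBy_zero_subst_witness4 L Φ hΦ0 hΦdet

/-! ## §6 The naive wild slice statement is refutable -/

/-- **THE WILD HALF OF T3″, NAIVELY STATED, IS REFUTABLE.**  The universally quantified statement «for every field `k`, weights
`w`, point `c` with `c_v ≠ 0 < w_v` and `(w_v : k) = 0` (WILD frozen coordinate `v` = last), every lattice `L`, every `F'` with
`F'(chart_c) = sᵃ·g` and every rank `α`: `GradedWonBy α (n+1) (sliceLattice (succLattice L w c) v) (sliceGerm v g) →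
GradedWonBy α (n+2) (succLattice L w c) g`» — the tame slice theorem `gradedWonBy_of_slice_tame` (p515424) with `(w_v : k) ≠ 0`
replaced by `(w_v : k) = 0` — FAILS at `k = 𝔽₂`, `n = 2`, `w = (1,1,2)`, `c = (0,1,1)`, `L = ⊤`, `F = x_u^10 + (x_v + x_u²)³x_z²`,
`a = 8`, `α = 0`: the slice is graded-won in one move (`gradedWonBy_zero_slice_wildSpecimen`), the successor is not
(`not_gradedWonBy_zero_wildSpecimen`).  DIAGNOSIS (see the module docstring): `v` is wild but NOT of minimal `2`-adic weight among
the translated coordinates (`w_u = 1`), so the slice `{y_v = 0}` is tangent to the orbit `y_v = y_u²` — a non-transversal slice is a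
Frobenius pull-back of the transversal one and can be strictly easier.  Not a statement about card A; the statement refuted is an
OURS candidate typing of the wild clause, recorded so that the registered stub carries the transversality hypothesis.
[OURS · L1 W4.3] -/
theorem not_gradedWonBy_of_slice_wild_naive :
    ¬ ∀ (k : Type) [Field k] (n : ℕ) (w : Fin (n + 1) → ℕ) (c : Fin (n + 1) → k) (α : Ordinal.{0})
        (L : AddSubgroup (Fin (n + 1) → ℤ)) (F' : MvPowerSeries (Fin (n + 1)) k) (a : ℕ) (g : MvPowerSeries (Fin (n + 1 + 1)) k),
        subst (CobordantGame.cruxChart k w c) F' = X 0 ^ a * g →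
        c (Fin.last n) ≠ 0 → 0 < w (Fin.last n) → ((w (Fin.last n) : ℕ) : k) = 0 →
        GradedWonBy α (n + 1) (sliceLattice (succLattice L w c) (Fin.last n)) (sliceGerm (Fin.last n) g) →
          GradedWonBy α (n + 1 + 1) (succLattice L w c) g := by
  intro H
  have h2 : ((2 : ℕ) : ZMod 2) = 0 := ZMod.natCast_self 2
  have h := H (ZMod 2) 2 ![1, 1, 2] ![(0 : ZMod 2), 1, 1] 0 ⊤ (X 1 ^ 10 + (X 2 + X 1 ^ 2) ^ 3 * X 0 ^ 2) 8
    (X 0 ^ 2 * (1 + X 2) ^ 10 + (X 3 + X 2 ^ 2) ^ 3 * X 1 ^ 2) subst_cruxChart_wildSpecimen (by simp) (by simp)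
    (by simpa using h2)
  rw [succLattice_wildSpecimen_eq_top, sliceLattice_top] at h
  exact not_gradedWonBy_zero_wildSpecimen ⊤ (h gradedWonBy_zero_slice_wildSpecimen)

/-- **… ALSO WITH IDEA-1'S FULL R3-T3 BINDER LIST (one-sided form).**  «For every field, every `L`-homogeneous `F`, every
`L`-graded move `(θ, w)`, every successor `g` at an exceptional point `c` (`IsSuccessorAt F θ w c a g`), every frozen coordinate
`i₀` with `c_{i₀} ≠ 0 < w_{i₀}` and every rank `α`: slice graded-won with rank `α` ⇒ successor graded-won with rank `α`» is
refutable — same specimen (`L = ⊤` so `F` is homogeneous and `θ = X` is graded; `i₀ = 2 = last`). [OURS · L1 W4.3] -/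
theorem not_gradedWonBy_of_slice_asTyped_oneSided :
    ¬ ∀ (k : Type) [Field k] (n : ℕ) (F : MvPowerSeries (Fin n) k) (L : AddSubgroup (Fin n → ℤ)),
        IsLHomogeneous L F → ∀ (θ : Fin n → MvPowerSeries (Fin n) k) (w : Fin n → ℕ), IsLGradedMove L θ w →
        ∀ (c : Fin n → k) (a : ℕ) (g : MvPowerSeries (Fin (n + 1)) k), IsSuccessorAt F θ w c a g →
        ∀ (i₀ : Fin n), c i₀ ≠ 0 → 0 < w i₀ → ∀ (α : Ordinal.{0}),
          GradedWonBy α n (sliceLattice (succLattice L w c) i₀) (sliceGerm i₀ g) →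
            GradedWonBy α (n + 1) (succLattice L w c) g := by
  intro H
  have h := H (ZMod 2) 3 (X 1 ^ 10 + (X 2 + X 1 ^ 2) ^ 3 * X 0 ^ 2) ⊤ (fun _ _ _ _ => AddSubgroup.mem_top _) (fun i => X i)
    ![1, 1, 2] (isLGradedMove_X ⊤ _ ⟨0, by simp⟩) ![(0 : ZMod 2), 1, 1] 8
    (X 0 ^ 2 * (1 + X 2) ^ 10 + (X 3 + X 2 ^ 2) ^ 3 * X 1 ^ 2) isSuccessorAt_wildSpecimen 2 (by simp) (by simp) 0
  have hlast : (2 : Fin 3) = Fin.last 2 := rfl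
  rw [hlast, succLattice_wildSpecimen_eq_top, sliceLattice_top] at h
  exact not_gradedWonBy_zero_wildSpecimen ⊤ (h gradedWonBy_zero_slice_wildSpecimen)

end GradedGame

end Summit.ResolutionOfSingularities.ResolutionOfSingularities.Theorems
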